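import Literature.NumberTheory.EllipticCurves.Rank1Residual.Typed.X7
import Literature.NumberTheory.EllipticCurves.Rank1Residual.Typed.X8
import Literature.NumberTheory.EllipticCurves.Rank1Residual.Typed.X10bHeegnerIndexCertificate
import HarnessLib

/-!
# Good supersingular classes X7 / X8 at a NON-SURJECTIVE prime, rank `0`, `ord_p #Ш_an = 2`: Cha's index bound (upper half) + the native `p`-descent line (lower half), PER PAIR

HONEST FRAMING (cell `b2b-bsdres`, run/shared/lean/b2b/bsd-rank1-residual/, verbatim in every
file): the goal of the cell is to DELETE the COMBINATION-SHAPED residual classes of the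
Birch–Swinnerton-Dyer formula for ALL analytic-rank `≤ 1` elliptic curves over `ℚ` — "full BSD
formula for every rank `≤ 1` curve in class `C`" assembled STRICTLY from published theorems — so
that the rank-`≤ 1` remainder becomes exactly the CONSTRUCTION-SHAPED classes, which are TYPED
(missing-input `Prop`s), NOT attempted. This is not "finishing BSD". Harvest seat 1 (census
support of X6 / X7 / X8; prover owners x10b + additive-p3), generation 23. Theorems only
(compositions of tree theorems BY NAME); no definition, no named fact; X7 and X8 REMAIN
CONSTRUCTION-SHAPED; nothing is booked; PER PAIR.

## What this file records, and why

x10b's `Supersingular/DescentLowerBound.lean` (p212413) closes, per pair, the rank-`0` X6 / X7 / X8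
pairs with `#Ш_an = 9` from the cell's two-engine exact `3`-descent (`Sel^(3)(E/ℚ) ≠ 0`, the LOWER
half, Cassels–Tate) and Wuthrich 2014 Prop. 21 (the UPPER half) — but Wuthrich's constant `C` is
divisible by the primes at which `ρ̄_{E,p}` is NEITHER surjective NOR Borel (Doc. Math. 19 (2014)
p. 400; tree `Wuthrich2014.sha_dvd_analyticSha`), so at a good supersingular prime with image the
normaliser of a non-split Cartan (Cremona `pNn`: irreducible by Serre 1972 Prop. 12, not surjective)
those consumers need a `Surj W p` datum that is FALSE: CLASS-OWNERS.md row X8 lists exactly the two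
window pairs `6241a1 @3`, `10816u1 @3` (`3Nn`, `r = 0`, `#Ш_an = 9`; sha-2 tier `T-full3`:
`dim_𝔽₃ Sel^(3)(E/ℚ) = 2` on BOTH engines — x11b `desc3lib.gp` EXACT and x10b `desc3full_e2.py`
j091560, same subspace) as "3Nn RESISTANT (no upper bound)".

The upper half IS in print per pair without surjectivity: Cha 2005 (Miller 2011 Thm. 5.2, tree fact
`Cha2005.thm52_padicValNat_shaOrder_le`, vendored by x9: `r_an ≤ 1`, `p ∤ 2 d_K`, `p² ∤ N`, `ρ̄_{E,p}`
IRREDUCIBLE, `E` non-CM ⇒ `ord_p #Ш(E/ℚ) ≤ 2 · ord_p [E(K) : ℤ y_K]`), once a Heegner field `K` is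
exhibited whose Heegner point has `ord_p [E(K) : ℤ y_K] ≤ 1`. This is x10b's X10b-RESISTANT pattern
(`Typed/X10bHeegnerIndexCertificate.lean`, p192705: the class-free
`Typed.bsdp_of_cha_of_casselsTate_of_selmerGroup_ne_bot` and its X10 instance for `10082b1`; GJPST
2009 Prop. 3.35 does the same for `681b`). Harvest-1's g22 non-unit complement
(`HOME/b2b-bsdres-harvest-1/g22/ssr0nn_nonunit/`) measured, with the cell's two Heegner-index
engines (engine 1 = x11c `main.py` 69e29ec7…, engine 2 = `run_cert.py` 1b54bb20…, byte-identical),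
`ord_3 [E(K) : ℤ y_K] = 1` EXACTLY at three Heegner fields each for `6241a1` (`D = −43, −148, −232`,
`m = 24`) and `10816u1` (`D = −55, −79, −607`, `m = 24`), both engines agreeing — the index is what
Gross–Zagier + BSD predict (`½ · ord_3 #Ш_an = 1`), so NO unit-index field exists and T-CHA's
certificate form (`3 ∤ index`, `Supersingular/ChaIndexRoute.lean`) is unavailable, but the
INEQUALITY form with `k = 1` meets the descent's lower half. This file supplies the X7 / X8 twins of
x10b's X10 theorems, with `irr(p)` DISCHARGED by the class (`ClassX7.irr`, `ClassX8.irr'`) and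
`p ∤ #E(ℚ)_tors` derived from it:

* `X7.bsdp_rankZero_of_cha_of_casselsTate_of_selmerGroup_ne_bot` (odd `p`), `X8.…` (`p = 3`):
  `r_an = 0`, `ord_p #Ш_an = 2`, Heegner datum with `p ∤ d_K`, `p² ∤ N`, `ord_p [E(K) : ℤ y_K] ≤ 1`,
  `Sel^(p)(E/ℚ) ≠ 0` ⇒ `BSD(E,p)`; the exact `p`-part `ord_p #Ш(E/ℚ) = 2`; and the typed residues
  `X7.MissingInputAt` / `X8.MissingInputAt` at such a pair;
* `X7/X8.bsdp_of_cha_of_casselsTate_of_dvd`: the general shape `r_an ≤ 1`, `ord_p #Ш_an = 2k`,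
  index `≤ k`, lower certificate `p^{2k−1} ∣ #Ш(E/ℚ)` (for `#Ш_an = 81`-type pairs, e.g. `288800cu1 @3`
  where the index has `ord_3 = 2` and a `3`-descent alone gives only `9 ∣ #Ш`);
* `bsdp_of_goodSS_of_cha_of_casselsTate_of_selmerGroup_ne_bot` — the common content on `GoodSS W p`,
  `p ≠ 2` (irreducibility from `p ∣ a_p`, Serre Prop. 12, tree
  `hasIrreducibleModPGaloisRep_of_dvd_frobeniusTrace`).

Census use (this seat, g23, `HOME/b2b-bsdres-harvest-1/g23/desc3nn/`; nothing booked): the 27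
rank-`0` `3Nn` good-supersingular pairs of the lane's v4 residue (`N < 5·10⁵`) with `3 ∣ #Ш_an`
(X7 9 / X8 18; window: `6241a1`, `10816u1`): `dim Sel^(3)(E/ℚ) ≥ 2` with two exhibited, exactly
verified elements on BOTH descent engines (x11b gen-8 bundle GRH mode j100742 = engine 1; x10b
`desc3full_e2.py` rev 2 lower-bound mode = engine 2, same subspace), and the g22 index valuation
`v = ord_3 [E(K) : ℤ y_K]`: `v = 1` on the 17 pairs with `#Ш_an = 9 · unit` and `3 ∤ ∏c_ℓ` (closable by
the theorems below, per pair, modulo the referee's ruling and the lane's booking), `v = 1 + S` on the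
`S = ord_3 ∏c_ℓ ≥ 1` pairs (upper bound `2 + 2S` only: NOT closable here — Jetchev's sharpening is
printed under surjectivity), `v = 2` on `288800cu1` (`#Ш_an = 81`).

References: B. Cha, J. Number Theory 111 (2005) 154–178 [Cha2005]; R. L. Miller, LMS J. Comput.
Math. 14 (2011) 327–350, Thm. 5.2, Def. 1.1 [Miller2011LMS]; G. Grigorov, A. Jorza, S. Patrikis,
W. Stein, C. Tarniţă, Math. Comp. 78 (2009) 2397–2425, Thm. 3.5, Prop. 3.35
[GrigorovJorzaPatrikisSteinTarnita2009]; J. W. S. Cassels, J. reine angew. Math. 211 (1962) 95–112 /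
J. H. Silverman, AEC, Thm. X.4.14 [SilvermanAEC2009]; J.-P. Serre, Invent. Math. 15 (1972) §1.11
Prop. 12 [Serre1972]; C. Wuthrich, Doc. Math. 19 (2014) Prop. 21 [Wuthrich2014] (why surjectivity
was needed before); E. F. Schaefer, M. Stoll, Trans. AMS 356 (2004) 1209–1231 (the descent);
RESIDUAL-CASES.md §a.2 X7/X8; CLASS-OWNERS.md rows X7, X8; HOME/b2b-bsdres-x10b/X678-DESC3.md
ADDENDUM 2–3; lane HYPOTHESES.md row T-CHA.
-/

noncomputable section

open scoped Classical

open WeierstrassCurve Literature.NumberTheory.EllipticCurves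
  Literature.NumberTheory.EllipticCurves.Rank1Residual
  Literature.NumberTheory.EllipticCurves.Rank1Residual.Typed

namespace Summit.BirchSwinnertonDyer.Rank1Residual.Supersingular

variable (W : WeierstrassCurve ℚ) [W.IsElliptic] [W.IsGloballyMinimal] (p : ℕ) [hp : Fact p.Prime]
  {N : ℕ} [NeZero N] {K : Type} [Field K] [NumberField K]

/-! ## §1 Class X7 (good supersingular, `E` not semistable), odd `p` -/

/-- **X7 ∩ {r_an = 0}, odd `p`, `ord_p #Ш_an = 2`: `BSD(E,p)` from PUBLISHED theorems plus two
finite certificates, with NO image datum** (valid at a non-surjective `pNn` prime). For a non-CM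
globally minimal `E/ℚ` in class X7 at `p ≠ 2` of analytic rank `0` with `#Ш(E/ℚ)_an = q`,
`ord_p q = 2`: given a Heegner field `K` (imaginary quadratic, Heegner hypothesis for the level `N`,
`p ∤ d_K`, `p² ∤ N`) with Heegner point `P = y_K` of infinite order carrying the index certificate
`ord_p [E(K) : ℤ P] ≤ 1`, and the `p`-descent line `Sel^(p)(E/ℚ) ≠ 0`, Miller's `BSD(E,p)` holds.
Named facts: GZK (`hGZK`), Cassels–Tate (`hCT`), Cha 2005 (`hCha`, Miller Thm. 5.2 —
irreducibility suffices; `irr(p)` is `ClassX7.irr`, Serre Prop. 12). Census instances (window):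
none in X7; beyond the window `118579a1/b1, 135200cy1, 309136g1, 379456fd1, 414050ca1 @3` (g23).
Per pair; NOT a class theorem; the lane books the certificates.
[cite: Miller2011LMS, Thm. 5.2 and Def. 1.1] [cite: SilvermanAEC2009, Thm. X.4.14]
[cite: Serre1972, §1.11 Prop. 12] [cite: GrigorovJorzaPatrikisSteinTarnita2009, Prop. 3.35] -/
theorem X7.bsdp_rankZero_of_cha_of_casselsTate_of_selmerGroup_ne_bot
    (hGZK : rank_eq_analyticRank_of_analyticRank_le_one)
    (hCT : exists_casselsTate_pairing (K := ℚ)) (hCha : Cha2005.thm52_padicValNat_shaOrder_le)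
    (hX : ClassX7 W p) (hp2 : p ≠ 2) (hcm : ¬ W.HasCM) (hr : W.analyticRank = 0)
    (hK : IsImaginaryQuadratic K) (hH : SatisfiesHeegnerHypothesis N K)
    {P : (W.baseChange K).toAffine.Point} (hP : IsHeegnerPoint N W K P) (hnt : ¬ IsOfFinAddOrder P)
    (hpD : ¬ (p : ℤ) ∣ NumberField.discr K) (hpN : ¬ p ^ 2 ∣ N)
    (hI : padicValNat p (AddSubgroup.zmultiples P).index ≤ 1)
    {q : ℚ} (hq : shaAn W = (q : ℂ)) (hv : padicValRat p q = 2)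
    (hSel : W.selmerGroup (p : ℤ) ≠ ⊥) : BSDp W p :=
  Typed.bsdp_of_cha_of_casselsTate_of_selmerGroup_ne_bot W p hGZK hCT hCha hcm hr hK hH hP hnt hp2
    hpD hpN (ClassX7.irr W p hp2 hX) hI hq hv hSel

/-- **The exact `p`-part on such an X7 pair: `ord_p #Ш(E/ℚ) = 2`** (the descent's `(ℤ/p)²` is all
of `Ш(E/ℚ)[p^∞]`). Lower: `Sel^(p) ≠ 0` at rank `0` with `p ∤ #E(ℚ)_tors` (irreducibility) gives
`p ∣ #Ш`, Cassels–Tate squareness gives `p² ∣ #Ш`; upper: Cha's bound with index `≤ 1`.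
[cite: Miller2011LMS, Thm. 5.2] [cite: SilvermanAEC2009, Thm. X.4.14] [cite: Serre1972, §1.11 Prop. 12] -/
theorem X7.padicValNat_shaOrder_eq_two_of_cha_of_selmerGroup_ne_bot
    (hGZK : rank_eq_analyticRank_of_analyticRank_le_one)
    (hCT : exists_casselsTate_pairing (K := ℚ)) (hCha : Cha2005.thm52_padicValNat_shaOrder_le)
    (hX : ClassX7 W p) (hp2 : p ≠ 2) (hcm : ¬ W.HasCM) (hr : W.analyticRank = 0)
    (hK : IsImaginaryQuadratic K) (hH : SatisfiesHeegnerHypothesis N K)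
    {P : (W.baseChange K).toAffine.Point} (hP : IsHeegnerPoint N W K P) (hnt : ¬ IsOfFinAddOrder P)
    (hpD : ¬ (p : ℤ) ∣ NumberField.discr K) (hpN : ¬ p ^ 2 ∣ N)
    (hI : padicValNat p (AddSubgroup.zmultiples P).index ≤ 1)
    (hSel : W.selmerGroup (p : ℤ) ≠ ⊥) : padicValNat p W.shaOrder = 2 := by
  have hr1 : W.analyticRank ≤ 1 := by rw [hr]; norm_num
  have hrank : W.mordellWeilRank = 0 := by rw [(hGZK W hr1).1, hr]
  have hirr : Irr W p := ClassX7.irr W p hp2 hX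
  have htors : ¬ p ∣ W.torsionOrder := by
    intro hd
    have h0 := padicValNat_torsionOrder_eq_zero_of_irreducible W p hirr
    rw [padicValNat.eq_zero_iff] at h0
    rcases h0 with h | h | h
    · exact absurd h hp.out.one_lt.ne'
    · exact absurd h W.torsionOrder_pos_holds.ne'
    · exact h hd
  have hdvd : p ∣ W.shaOrder :=
    dvd_shaOrder_of_exists_torsion W p
      (exists_sha_torsion_of_selmerGroup_ne_bot W p hSel hrank htors)
  simpa using Typed.padicValNat_shaOrder_eq_of_cha_of_casselsTate_of_dvd W p hGZK hCT hCha hcm hr1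
    hK hH hP hnt hp2 hpD hpN hirr (k := 1) hI (by simpa using hdvd)

/-- **X7's typed residue `X7.MissingInputAt W p` is discharged at such a pair** (bookkeeping: both
clauses of `Typed/X7.lean`'s missing input follow from `BSD(E,p)`).
[cite: Miller2011LMS, Thm. 5.2 and Def. 1.1] [cite: SilvermanAEC2009, Thm. X.4.14] -/
theorem X7.missingInputAt_of_cha_of_casselsTate_of_selmerGroup_ne_bot
    (hGZK : rank_eq_analyticRank_of_analyticRank_le_one)
    (hCT : exists_casselsTate_pairing (K := ℚ)) (hCha : Cha2005.thm52_padicValNat_shaOrder_le)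
    (hX : ClassX7 W p) (hp2 : p ≠ 2) (hcm : ¬ W.HasCM) (hr : W.analyticRank = 0)
    (hK : IsImaginaryQuadratic K) (hH : SatisfiesHeegnerHypothesis N K)
    {P : (W.baseChange K).toAffine.Point} (hP : IsHeegnerPoint N W K P) (hnt : ¬ IsOfFinAddOrder P)
    (hpD : ¬ (p : ℤ) ∣ NumberField.discr K) (hpN : ¬ p ^ 2 ∣ N)
    (hI : padicValNat p (AddSubgroup.zmultiples P).index ≤ 1)
    {q : ℚ} (hq : shaAn W = (q : ℂ)) (hv : padicValRat p q = 2)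
    (hSel : W.selmerGroup (p : ℤ) ≠ ⊥) : X7.MissingInputAt W p := by
  have hr1 : W.analyticRank ≤ 1 := by rw [hr]; norm_num
  haveI : Finite W.sha := (hGZK W hr1).2
  have hB := X7.bsdp_rankZero_of_cha_of_casselsTate_of_selmerGroup_ne_bot W p hGZK hCT hCha hX hp2
    hcm hr hK hH hP hnt hpD hpN hI hq hv hSel
  have hPP := missingPPartAt_of_bsdp W p hB
  exact ⟨fun _ _ _ ↦ (lower_and_upper_of_missingPPartAt W p hPP).1, fun _ ↦ hPP⟩

/-- **X7, any analytic rank `≤ 1`, general exponent: `ord_p #Ш_an = 2k`, index certificate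
`ord_p [E(K) : ℤ y_K] ≤ k`, lower certificate `p^{2k−1} ∣ #Ш(E/ℚ)` ⇒ `BSD(E,p)`** (x10b's
`Typed.bsdp_of_cha_of_casselsTate_of_dvd` with `irr(p)` from the class). For `#Ш_an = 81`-type
pairs (`k = 2`), where a `p`-descent alone certifies only `p² ∣ #Ш`. Per pair.
[cite: Miller2011LMS, Thm. 5.2 and Def. 1.1] [cite: SilvermanAEC2009, Thm. X.4.14] [cite: Serre1972, §1.11 Prop. 12] -/
theorem X7.bsdp_of_cha_of_casselsTate_of_dvd (hGZK : rank_eq_analyticRank_of_analyticRank_le_one)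
    (hCT : exists_casselsTate_pairing (K := ℚ)) (hCha : Cha2005.thm52_padicValNat_shaOrder_le)
    (hX : ClassX7 W p) (hp2 : p ≠ 2) (hcm : ¬ W.HasCM) (hr : W.analyticRank ≤ 1)
    (hK : IsImaginaryQuadratic K) (hH : SatisfiesHeegnerHypothesis N K)
    {P : (W.baseChange K).toAffine.Point} (hP : IsHeegnerPoint N W K P) (hnt : ¬ IsOfFinAddOrder P)
    (hpD : ¬ (p : ℤ) ∣ NumberField.discr K) (hpN : ¬ p ^ 2 ∣ N)
    {k : ℕ} (hI : padicValNat p (AddSubgroup.zmultiples P).index ≤ k)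
    {q : ℚ} (hq : shaAn W = (q : ℂ)) (hv : padicValRat p q = 2 * k)
    (hdvd : p ^ (2 * k - 1) ∣ W.shaOrder) : BSDp W p :=
  Typed.bsdp_of_cha_of_casselsTate_of_dvd W p hGZK hCT hCha hcm hr hK hH hP hnt hp2 hpD hpN
    (ClassX7.irr W p hp2 hX) hI hq hv hdvd

/-! ## §2 Class X8 (`p = 3` good supersingular, `a_3 = ±3`) -/

/-- **X8 ∩ {r_an = 0}, `ord_3 #Ш_an = 2`: `BSD(E,3)` from PUBLISHED theorems plus two finite
certificates, with NO image datum** — the shape of the two CLASS-OWNERS "3Nn RESISTANT" window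
pairs `6241a1 @3` (Heegner field `ℚ(√−43)`, `m = 24`, `ord_3 = 1` on both index engines; `dim Sel₃ = 2`
on both descent engines) and `10816u1 @3` (`ℚ(√−55)`, `m = 24`; `dim Sel₃ = 2`), and of the
beyond-window X8 pairs of g23 (`23104bi1/bk1, 78400dc1/lg1, 87616t1, 96800cn1, 144400bs1, 203456ce1,
379456js1, 442225bi1, 474320e1`). `ClassX8 W p` forces `p = 3`; `irr(3)` is `ClassX8.irr'` (good
supersingular, `a_3 = ±3 ≡ 0 (mod 3)`: Serre Prop. 12); Cha's bound allows `p = 3` (only `p ∤ 2 d_K` is printed).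
Per pair; NOT a class theorem; the lane books the certificates.
[cite: Miller2011LMS, Thm. 5.2 and Def. 1.1] [cite: SilvermanAEC2009, Thm. X.4.14]
[cite: Serre1972, §1.11 Prop. 12] [cite: GrigorovJorzaPatrikisSteinTarnita2009, Prop. 3.35] -/
theorem X8.bsdp_rankZero_of_cha_of_casselsTate_of_selmerGroup_ne_bot
    (hGZK : rank_eq_analyticRank_of_analyticRank_le_one)
    (hCT : exists_casselsTate_pairing (K := ℚ)) (hCha : Cha2005.thm52_padicValNat_shaOrder_le)
    (hX : ClassX8 W p) (hcm : ¬ W.HasCM) (hr : W.analyticRank = 0)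
    (hK : IsImaginaryQuadratic K) (hH : SatisfiesHeegnerHypothesis N K)
    {P : (W.baseChange K).toAffine.Point} (hP : IsHeegnerPoint N W K P) (hnt : ¬ IsOfFinAddOrder P)
    (hpD : ¬ (p : ℤ) ∣ NumberField.discr K) (hpN : ¬ p ^ 2 ∣ N)
    (hI : padicValNat p (AddSubgroup.zmultiples P).index ≤ 1)
    {q : ℚ} (hq : shaAn W = (q : ℂ)) (hv : padicValRat p q = 2)
    (hSel : W.selmerGroup (p : ℤ) ≠ ⊥) : BSDp W p := by
  have hp2 : p ≠ 2 := by rw [hX.1]; decide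
  exact Typed.bsdp_of_cha_of_casselsTate_of_selmerGroup_ne_bot W p hGZK hCT hCha hcm hr hK hH hP
    hnt hp2 hpD hpN (ClassX8.irr' W p hX) hI hq hv hSel

/-- **The exact `3`-part on such an X8 pair: `ord_3 #Ш(E/ℚ) = 2`**, i.e. `Ш(E/ℚ)[3^∞]` has order
`9`. [cite: Miller2011LMS, Thm. 5.2] [cite: SilvermanAEC2009, Thm. X.4.14] [cite: Serre1972, §1.11 Prop. 12] -/
theorem X8.padicValNat_shaOrder_eq_two_of_cha_of_selmerGroup_ne_bot
    (hGZK : rank_eq_analyticRank_of_analyticRank_le_one)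
    (hCT : exists_casselsTate_pairing (K := ℚ)) (hCha : Cha2005.thm52_padicValNat_shaOrder_le)
    (hX : ClassX8 W p) (hcm : ¬ W.HasCM) (hr : W.analyticRank = 0)
    (hK : IsImaginaryQuadratic K) (hH : SatisfiesHeegnerHypothesis N K)
    {P : (W.baseChange K).toAffine.Point} (hP : IsHeegnerPoint N W K P) (hnt : ¬ IsOfFinAddOrder P)
    (hpD : ¬ (p : ℤ) ∣ NumberField.discr K) (hpN : ¬ p ^ 2 ∣ N)
    (hI : padicValNat p (AddSubgroup.zmultiples P).index ≤ 1)
    (hSel : W.selmerGroup (p : ℤ) ≠ ⊥) : padicValNat p W.shaOrder = 2 := by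
  have hp2 : p ≠ 2 := by rw [hX.1]; decide
  have hr1 : W.analyticRank ≤ 1 := by rw [hr]; norm_num
  have hrank : W.mordellWeilRank = 0 := by rw [(hGZK W hr1).1, hr]
  have hirr : Irr W p := ClassX8.irr' W p hX
  have htors : ¬ p ∣ W.torsionOrder := by
    intro hd
    have h0 := padicValNat_torsionOrder_eq_zero_of_irreducible W p hirr
    rw [padicValNat.eq_zero_iff] at h0
    rcases h0 with h | h | h
    · exact absurd h hp.out.one_lt.ne'
    · exact absurd h W.torsionOrder_pos_holds.ne'
    · exact h hd
  have hdvd : p ∣ W.shaOrder :=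
    dvd_shaOrder_of_exists_torsion W p
      (exists_sha_torsion_of_selmerGroup_ne_bot W p hSel hrank htors)
  simpa using Typed.padicValNat_shaOrder_eq_of_cha_of_casselsTate_of_dvd W p hGZK hCT hCha hcm hr1
    hK hH hP hnt hp2 hpD hpN hirr (k := 1) hI (by simpa using hdvd)

/-- **X8's typed residue `X8.MissingInputAt W p` is discharged at such a pair** (bookkeeping).
[cite: Miller2011LMS, Thm. 5.2 and Def. 1.1] [cite: SilvermanAEC2009, Thm. X.4.14] -/
theorem X8.missingInputAt_of_cha_of_casselsTate_of_selmerGroup_ne_bot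
    (hGZK : rank_eq_analyticRank_of_analyticRank_le_one)
    (hCT : exists_casselsTate_pairing (K := ℚ)) (hCha : Cha2005.thm52_padicValNat_shaOrder_le)
    (hX : ClassX8 W p) (hcm : ¬ W.HasCM) (hr : W.analyticRank = 0)
    (hK : IsImaginaryQuadratic K) (hH : SatisfiesHeegnerHypothesis N K)
    {P : (W.baseChange K).toAffine.Point} (hP : IsHeegnerPoint N W K P) (hnt : ¬ IsOfFinAddOrder P)
    (hpD : ¬ (p : ℤ) ∣ NumberField.discr K) (hpN : ¬ p ^ 2 ∣ N)
    (hI : padicValNat p (AddSubgroup.zmultiples P).index ≤ 1)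
    {q : ℚ} (hq : shaAn W = (q : ℂ)) (hv : padicValRat p q = 2)
    (hSel : W.selmerGroup (p : ℤ) ≠ ⊥) : X8.MissingInputAt W p := by
  have hr1 : W.analyticRank ≤ 1 := by rw [hr]; norm_num
  haveI : Finite W.sha := (hGZK W hr1).2
  have hB := X8.bsdp_rankZero_of_cha_of_casselsTate_of_selmerGroup_ne_bot W p hGZK hCT hCha hX hcm
    hr hK hH hP hnt hpD hpN hI hq hv hSel
  have hPP := missingPPartAt_of_bsdp W p hB
  exact ⟨fun _ _ ↦ (lower_and_upper_of_missingPPartAt W p hPP).1, fun _ ↦ hPP⟩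

/-- **X8, any analytic rank `≤ 1`, general exponent**: `ord_3 #Ш_an = 2k`, index `≤ k`,
`3^{2k−1} ∣ #Ш(E/ℚ)` ⇒ `BSD(E,3)` (e.g. `288800cu1 @3`: `#Ш_an = 81`, `ord_3` of the index `= 2` at
`D = −319, −1591, −31` — needs `27 ∣ #Ш`, which a `3`-descent does not give: recorded OPEN). Per pair.
[cite: Miller2011LMS, Thm. 5.2 and Def. 1.1] [cite: SilvermanAEC2009, Thm. X.4.14] [cite: Serre1972, §1.11 Prop. 12] -/
theorem X8.bsdp_of_cha_of_casselsTate_of_dvd (hGZK : rank_eq_analyticRank_of_analyticRank_le_one)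
    (hCT : exists_casselsTate_pairing (K := ℚ)) (hCha : Cha2005.thm52_padicValNat_shaOrder_le)
    (hX : ClassX8 W p) (hcm : ¬ W.HasCM) (hr : W.analyticRank ≤ 1)
    (hK : IsImaginaryQuadratic K) (hH : SatisfiesHeegnerHypothesis N K)
    {P : (W.baseChange K).toAffine.Point} (hP : IsHeegnerPoint N W K P) (hnt : ¬ IsOfFinAddOrder P)
    (hpD : ¬ (p : ℤ) ∣ NumberField.discr K) (hpN : ¬ p ^ 2 ∣ N)
    {k : ℕ} (hI : padicValNat p (AddSubgroup.zmultiples P).index ≤ k)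
    {q : ℚ} (hq : shaAn W = (q : ℂ)) (hv : padicValRat p q = 2 * k)
    (hdvd : p ^ (2 * k - 1) ∣ W.shaOrder) : BSDp W p := by
  have hp2 : p ≠ 2 := by rw [hX.1]; decide
  exact Typed.bsdp_of_cha_of_casselsTate_of_dvd W p hGZK hCT hCha hcm hr hK hH hP hnt hp2 hpD hpN
    (ClassX8.irr' W p hX) hI hq hv hdvd

/-! ## §3 Any good supersingular pair -/

/-- **Good supersingular `p ≠ 2`, any non-CM `E` of analytic rank `0` with `ord_p #Ш_an = 2`: the
Cha + Cassels–Tate + descent booking shape with `irr(p)` from Serre Prop. 12** (`GoodSS W p`: good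
reduction at `p`, `p ∣ a_p`). The common content of §1–§2.
[cite: Miller2011LMS, Thm. 5.2 and Def. 1.1] [cite: SilvermanAEC2009, Thm. X.4.14] [cite: Serre1972, §1.11 Prop. 12] -/
theorem bsdp_of_goodSS_of_cha_of_casselsTate_of_selmerGroup_ne_bot
    (hGZK : rank_eq_analyticRank_of_analyticRank_le_one)
    (hCT : exists_casselsTate_pairing (K := ℚ)) (hCha : Cha2005.thm52_padicValNat_shaOrder_le)
    (hss : GoodSS W p) (hp2 : p ≠ 2) (hcm : ¬ W.HasCM) (hr : W.analyticRank = 0)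
    (hK : IsImaginaryQuadratic K) (hH : SatisfiesHeegnerHypothesis N K)
    {P : (W.baseChange K).toAffine.Point} (hP : IsHeegnerPoint N W K P) (hnt : ¬ IsOfFinAddOrder P)
    (hpD : ¬ (p : ℤ) ∣ NumberField.discr K) (hpN : ¬ p ^ 2 ∣ N)
    (hI : padicValNat p (AddSubgroup.zmultiples P).index ≤ 1)
    {q : ℚ} (hq : shaAn W = (q : ℂ)) (hv : padicValRat p q = 2)
    (hSel : W.selmerGroup (p : ℤ) ≠ ⊥) : BSDp W p :=
  Typed.bsdp_of_cha_of_casselsTate_of_selmerGroup_ne_bot W p hGZK hCT hCha hcm hr hK hH hP hnt hp2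
    hpD hpN
    (hasIrreducibleModPGaloisRep_of_dvd_frobeniusTrace W p hp2
      (W.not_dvd_minimalDiscriminantInt_of_hasGoodReductionAtPrime' p hss.1) hss.2)
    hI hq hv hSel

end Summit.BirchSwinnertonDyer.Rank1Residual.Supersingular

end
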